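import Summits.ABC.Analytic.PeriodSandwich
import Literature.NumberTheory.EllipticCurves.ModularSymbols
import Literature.NumberTheory.EllipticCurves.BSDHeegnerPoints
import Literature.NumberTheory.EllipticCurves.BSDRootNumberSmallConductorProofs
import HarnessLib
import HarnessLib.Audit

/-!
# ABC — analytic / modular lens (IV): the PERIOD door — typed rows and Goldfeld's dictionary

Cell `abc-an` (C1), seat `pr-1` (KEY PR-THMDOORS, rows R14/R15/R17 of lens-5 and R24 of lens-6; THMDOOR-1/2 as
named by the plan seat 2026-08-27T18:16Z). Files I–III (`Requirements`, `RequirementsCongruence`,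
`RequirementsSharp`) type the modular-degree / height / congruence-number doors; this file types the PERIOD face of
the height door and PROVES Goldfeld's dictionary «modular symbols ⇒ periods ⇒ height ⇒ A-PS» as an implication,
on top of the proof-only companions `PeriodSandwich` (the period sandwich `Ω⁺_f Ω⁻_f ≤ 652 covol(Λ_E)` and Birch's
formula as a period bound) and `DegreeLowerBounds` (THMDOOR-2: lower bounds for `deg φ` and `r_f`).

HONESTY: abc is not proved by any of this. The target of the door theorems is **A-PS** = polynomial Szpiro over `ℚ`
(`Summit.ABC.PolySzpiroRat`), which is **NOT abc — «NOT abc — POLY-SZPIRO(E)»** (HUMAN D-0139/D-0140); full abc /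
Szpiro `6+ε` (rung A0) is the main goal. Typed ≠ proved: every `@[conjecture] def` below is an OPEN statement used
only as a hypothesis; every `theorem` is sorry-free and uses no named fact unless it appears in its signature.

## Contents

§1 OPEN rows (proof-free `Prop`s):
* `PolyPeriodLowerBoundRatEff κ C` / `PolyPeriodLowerBoundRat κ` — Goldfeld's period form of Szpiro,
  `covol(Λ_E) = complexPeriod/2 ≥ e^{-C} N_E^{-2κ}` (Goldfeld 1990 §4 (4), 1992 (3): "Szpiro's conjecture is
  equivalent to lower bounds of type `Ω₂ ≫ N^{-κ}`").
* `PolyModSymRat κ B` — Goldfeld's modular-symbol conjecture (1990 Conj. 4) in Cremona / Mazur–Tate–Teitelbaum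
  currency: the normalised symbols `[a/q]^±_f` at primes `q ≤ N^B` are `≤ C N^κ`.
* `TwistedCentralValueLowerBound B β` — the ONE analytic input of the dictionary: for each parity a primitive
  character `χ` of prime conductor `q ≤ C N^B` with `|L(f ⊗ χ, 1)| ≥ c N^{-β}` (VALUE form; see its docstring for
  what is and is not in print).
* `PolyShaAnRat A`, `PolyHeegnerHeightRat A B` — rows R14/R15 (analytic-Ш and Heegner-height currencies), typed
  over the tree's `shaAn`, `heegnerPointComplex`, `canonicalHeight`; inputs only, no theorem here uses them.

§2 THMDOOR-1a (PROVED, hypothesis-free): `PolyPeriodLowerBoundRat κ ↔ PolyFaltingsHeightRat κ` with both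
effective directions (`h_F = −½ log(complexPeriod/2)` on a global minimal model, tree
`faltingsHeight_eq_neg_half_log`), and BY NAME `PolyPeriodLowerBoundRat κ → Summit.ABC.PolySzpiroRat`
(exponent `12κ`; effective twin with constant `6C + 16`). The certificate that the period row is a RESTATEMENT of
the height door R5 inside the A-PS class.

§3 THMDOOR-1b, the GOLDFELD DICTIONARY THEOREM (PROVED as an implication; Goldfeld 1990 "Conj. 4 ⇒ Conj. 1 assuming
Taniyama–Weil", with TW = `nonempty_modularParametrizationData` a named KNOWN fact and the analytic input TYPED):
`PolyModSymRat κ B → TwistedCentralValueLowerBound B β → PolyPeriodLowerBoundRat (κ + β + B/2)`, hence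
`→ PolyFaltingsHeightRat (κ + β + B/2) → Summit.ABC.PolySzpiroRat` (exponent `12κ + 12β + 6B`), modulo modularity
and Mazur–Kenku. Chain (all PROVED, in `PeriodSandwich`): Birch's formula `τ(χ̄) L(f,χ,1) = Σ_a χ̄(a){∞,a/q}_f`,
`|τ(χ̄)|² = q`, parity splitting of the symbol sum, `plusSymbol = re{∞,r}` for the real newform, so
`√q |L(f,χ,1)| ≤ q · C N^κ · Ω^±_f`, i.e. `Ω^±_f ≥ c N^{-β} / (C √q N^κ) ≥ c' N^{-(κ+β+B/2)}` per parity; then the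
PERIOD SANDWICH `Ω⁺_f Ω⁻_f ≤ 652 covol(Λ_E)` (`periods_le_mul_covolume`: lattice-optimal datum, `Ω(E₀) = |c₀|Ω⁺_f`,
`m|Ω⁻(E₀)| = |c₀|Ω⁻_f`, Zagier twice, `c_E² ≥ 1`, Mazur–Kenku `163`). The Manin constant enters with the HELPFUL
sign in this direction: NO `PolyManinRat` hypothesis is needed (correcting lens-5's exponent map M17 `κ + μ`:
`μ = 0` for free).

References: [Goldfeld1990ModularElliptic] §4, Conj. 1, Conj. 4, (4)–(8); [Goldfeld1992ModularSymbols]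
p. 808 (2)–(3); [Birch1971]; [MazurTateTeitelbaum1986] §I.8 (8.6); [CremonaAlgorithms1997] §2.8, §2.10, §3.7;
[ZagierCMB1985] §1; [EdixhovenManin1991] Prop. 2; [Knapp1993] Prop. 12.9; [Mazur1978]; [Kenku1982];
[HoffsteinKontorovich2010] Thm. 4; [HoffsteinLockhart1994]; [AgasheRibetStein2012] Thm. 2.1;
[MurtyCongruencePrimes1999]; [PastenShimura2024] §3; [GoldfeldSzpiro1995] (1.1); [GrossZagier1986] Thm. I.6.3.
-/

noncomputable section

open scoped MatrixGroups ModularForm Classical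

namespace Summit.ABC.Analytic

open Literature.NumberTheory.EllipticCurves Literature.NumberTheory.EllipticCurves.ModularForms
open CongruenceSubgroup WeierstrassCurve

/-! ## §1 OPEN rows (proof-free; used only as hypotheses) -/

/-- **R17♭ Goldfeld's period lower bound, effective form `(κ, C)`**: for every globally minimal elliptic `W/ℚ`,
`covol(Λ_W) = complexPeriod/2 ≥ e^{-C} · N_W^{-2κ}` (Goldfeld 1990 §4 (4) "Szpiro's conjecture is equivalent to
lower bounds of type `Ω₂ ≫ N^{-κ}`"; Goldfeld 1992 (3) `N^{-κ} ≪ |Ω_i|`; `covol = Ω⁺·|Ω⁻|/[Λ:Λ₀]`). OPEN; a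
RESTATEMENT of the height row R5 with the same exponent (`polyPeriodLowerBoundRat_iff_polyFaltingsHeightRat`).
«NOT abc — POLY-SZPIRO(E = 12κ)» (D-0139/D-0140). CALIBRATION (REDUCTION CENSUS §R R2, 2026-08-27; computed ≠ proved
— a FLOOR on the admissible explicit `(κ, C)`, never evidence): this Prop is `PolyFaltingsHeightRatEff κ (C/2)` read
through `covol = e^{−2 h_F}` (`polyFaltingsHeightRatEff_of_polyPeriodLowerBoundRatEff`), so the ENG-HEIGHT numbers apply
verbatim (kit j285597, `h_F = −½ log covol` of the minimal model's period lattice for ALL 3,064,705 curves `N < 500000`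
of Cremona's `ecdata`; Sage cross-check j285791): max `h_F / log N = 0.631292` at 279366b1 ⇒ `C = 0` forces
`κ ≥ 0.6313`; `κ = ½` forces `C/2 ≥ 1.6464`, i.e. `C ≥ 3.2928`, still rising at the edge of the range (`+0.15` per
doubling in `C/2`); OUT OF RANGE (E-B kit job j288511, abc-an-eng-3 memo 70ea872ef01373a8, row ENG-INEQ-3; beds = high-quality abc
triples read as Frey curves): the Frey class of `19·1307 + 7·29²·31⁸ = 2⁸·3²²·5⁴` (quality `1.6235`, `N = 4,688,222,070`) has
`h_F/log N = 0.69502`, so `C = 0` forces `κ ≥ 0.69502` (266 bed curves beat the in-range `0.631292`); `κ ≤ ½` is refuted for EVERY `C`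
(Masser, via `not_polyFaltingsHeightRat_of_le_half`).
[cite: Goldfeld1990ModularElliptic, §4 (4)] [cite: Goldfeld1992ModularSymbols, p. 808 (2)–(3)] -/
@[conjecture] def PolyPeriodLowerBoundRatEff (κ C : ℝ) : Prop :=
  ∀ (W : WeierstrassCurve ℚ) [W.IsElliptic] [W.IsGloballyMinimal],
    Real.exp (-C) * ((W.conductorNorm ℤ : ℝ)) ^ (-(2 * κ)) ≤ (W.baseChange ℂ).complexPeriod / 2

/-- **R17♭**: `∃ C` form of Goldfeld's period lower bound with exponent `κ`. OPEN.
«NOT abc — POLY-SZPIRO(E = 12κ)» (D-0139/D-0140). CALIBRATION (computed ≠ proved; ENG-HEIGHT j285597, table under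
`PolyFaltingsHeightRatEff`): in range a witness needs `κ ≥ 0.6313` at `C = 0`, `C ≥ 3.2928` at `κ = ½` (279366b1);
out of range `κ ≥ 0.69502` at `C = 0` (E-B j288511); `κ ≤ ½` refuted (R5 floor). [cite: Goldfeld1990ModularElliptic, §4 (4)] -/
@[conjecture] def PolyPeriodLowerBoundRat (κ : ℝ) : Prop := ∃ C : ℝ, PolyPeriodLowerBoundRatEff κ C

/-- **R17(b) `PolyModSymRat κ B`** (Goldfeld's modular-symbol conjecture, Goldfeld 1990 Conj. 4 "`H(γ) = mΩ₁ + nΩ₂`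
with `|m|, |n| ≪ N^κ` for `|c| ≤ N²`", in Cremona / Mazur–Tate–Teitelbaum currency): for every elliptic `W/ℚ` of
conductor `N` with a modular parametrisation datum `Dt` (newform `Dt.f`), every prime `q ≤ N^B` and every `a`, the
normalised modular symbols `[a/q]^± = re{∞,a/q}/Ω⁺_f`, `im{∞,a/q}/Ω⁻_f` (tree `normalizedPlusSymbol`,
`normalizedMinusSymbol`; rational with bounded denominators, `IsNewform0.exists_rat_smul_plusPeriod`) are
`≤ C · N^κ` in absolute value. OPEN (Goldfeld: "on the basis of numerical evidence … `κ` arbitrarily small … on a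
minimal set of generators"); with `TwistedCentralValueLowerBound B β` it gives `PolyPeriodLowerBoundRat (κ+β+B/2)`
(`polyPeriodLowerBoundRat_of_polyModSymRat`, PROVED). «NOT abc — POLY-SZPIRO(E)» input (D-0139/D-0140).
CALIBRATION (REDUCTION CENSUS §R R2, 2026-08-27; computed ≠ proved — a FLOOR on `(κ, C)`, never evidence; lens-6 kit
j285435, sage/eclib, 20 curves `N ≤ 10⁴`): `κ̂ = log max|x^±| / log N = 0.79` at 1290h1 (9510e1 `0.762`, 858k2
`0.762`); `κ̂ ≥ σ_E/12 − 0.05` on 20/20 sampled curves (`σ_E` the Szpiro ratio; Masser's floor `σ > 6` reads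
`κ > ½` through the dictionary and the R5 floor); the full-range modular-symbol sup per level `N ≤ 10⁴` against
this Prop AS TYPED (prime `q ≤ N^B`, all `a`, both signs) is ENG-MSYM (b), seat abc-an-eng-1, pending — cite its kit
job id here when it lands. TYPING NOTES (referee abc-an-ref-2, REF-A2 §F9, 2026-08-27): (P1) CONTENT ONLY FOR `B > 0` —
for `B ≤ 0` there is no prime `q ≤ N^B ≤ 1`, so the row is trivially TRUE there (probe `polyModSymRat_of_nonpos`,
chk/Probe_F9.lean 396c8be64fc1f615); (N2) PRIME `q` is NOT in print — Goldfeld's Conj. 4 is stated for ALL `γ` with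
`|c| ≤ N²`; primality is bookkeeping of the dictionary proof only (it feeds the twisted row's prime back in). The
constant-carrying, all-moduli form `PolyModSymRatC κ B` (`∀ C_B ≥ 1`, moduli `0 < q ≤ C_B · N^B`; file
`RequirementsPeriodC`, v1.2) implies this row (`polyModSymRat_of_polyModSymRatC`).
[cite: Goldfeld1990ModularElliptic, §4 Conj. 4] [cite: Goldfeld1992ModularSymbols, (3)] -/
@[conjecture] def PolyModSymRat (κ B : ℝ) : Prop :=
  ∃ C : ℝ, ∀ (W : WeierstrassCurve ℚ) [W.IsElliptic] (N : ℕ) [NeZero N]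
    (Dt : ModularParametrizationData W N), W.conductorNorm ℤ = N →
    ∀ q : ℕ, q.Prime → (q : ℝ) ≤ (N : ℝ) ^ B → ∀ a : ℤ,
      |normalizedPlusSymbol Dt.f ((a : ℚ) / q)| ≤ C * (N : ℝ) ^ κ ∧
      |normalizedMinusSymbol Dt.f ((a : ℚ) / q)| ≤ C * (N : ℝ) ^ κ

/-- **R24 `TwistedCentralValueLowerBound B β` — a not-too-small twisted central value of small prime conductor, of
each parity (VALUE form of lens-6's «least good twist»).** For some `C, c > 0`: for every elliptic `W/ℚ` of
conductor `N` with datum `Dt` and each sign `sgn = ±1` there are a prime `q ≤ N^B` (constants absorbed in `B`, as in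
`PolyModSymRat`) and a PRIMITIVE Dirichlet
character `χ mod q` with `χ(−1) = sgn` such that the (entire continuation of the) twisted `L`-series
`L(f ⊗ χ, s) = Σ χ(n) aₙ n^{-s}` of the newform `f = Dt.f` satisfies `|L(f ⊗ χ, 1)| ≥ c · N^{-β}` (the continuation
exists and is unique, tree `exists_differentiable_eq_twistedLSeries_holds`; the `∃ L` idiom is that of the tree's
Birch formula `twisted_LValue_eq`). STATUS — what is in print: NON-VANISHING with `B = 1 + ε` for QUADRATIC twists
is a theorem (Hoffstein–Kontorovich 2010, Thm. 4: `∃ d, |d| ≪_ε N^{1+ε}, L(½, π ⊗ χ_d) ≠ 0`, proved by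
contradiction from the residue of the double Dirichlet series — explicitly WITHOUT a level-uniform first moment, so
NO value bound); Goldfeld 1990's printed pair is `(B, β) = (2, 0)` via the Waldspurger / Kohnen–Zagier mean value
(sketch level, (8) and the display after it); NO level-uniform VALUE lower bound at `B < 2` is in print (abc-an
lens-6 correction 2026-08-27T17:33Z). It is the input that "decides the `+6B`" in every `L`-value door. An INPUT, not
a door; NOT abc. TYPING NOTES (referee abc-an-ref-2, REF-A2 §F9, 2026-08-27; v1.2): (N1) CALIBRATION — a junk edge of
THIS typing (prime `q ≤ N^B`, NO constant in front of `N^B`), certified, not evidence about central values: the row is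
FALSE as typed for every `B < log 5 / log 11 ≈ 0.671` independently of `β`, modulo {a modular parametrisation datum,
a conductor-`11` curve (11a1)} — the even-sign clause needs an even primitive character of prime conductor
`q ≤ 11^B < 5` and there is none (mod `2` nothing is primitive, mod `3` the primitive character is odd; the odd sign
binds below `log 3 / log 11 ≈ 0.458`); kernel: `not_twistedCentralValueLowerBound_of_rpow_lt_five` /
`…_of_le_two_thirds` (file `RequirementsPeriodC`), after the referee's probe chk/Probe_F9.lean 396c8be64fc1f615. So
«OPEN as typed» holds only for `B ≥ 0.68`; the Lindelöf-range (`B = ½ + ε`) and «`B → 0`» least-twist shapes need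
the constant: REPAIRED row `TwistedCentralValueLowerBoundC B β` (`∃ C_B ≥ 1`, modulus `0 < q ≤ C_B · N^B`), which
this row implies (`twistedCentralValueLowerBoundC_of_twistedCentralValueLowerBound`, `C_B := 1`). (N2) PRIME `q` is
NOT in print: Goldfeld 1990 (7)–(8) takes real primitive `χ mod q` with `q ≪ N²`, composite allowed;
Hoffstein–Kontorovich 2010 Thm. 4 gives a FUNDAMENTAL DISCRIMINANT `d`, not a prime — the C-row drops primality.
(N3) HK 2010 Thm. 4 carries the hypothesis «the root number of `L(s, π)` is not `−1`» (degree `r = 2`: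
`|d| ≪_ε N^{1+ε}` with `L(½, π ⊗ χ_d) ≠ 0`), and the sign of `d` is unspecified there.
[cite: HoffsteinKontorovich2010, Thm. 4 (arXiv:1008.0839 p. 3)] [cite: Goldfeld1990ModularElliptic, §4 (8)] -/
@[conjecture] def TwistedCentralValueLowerBound (B β : ℝ) : Prop :=
  ∃ c : ℝ, 0 < c ∧ ∀ (W : WeierstrassCurve ℚ) [W.IsElliptic] (N : ℕ) [NeZero N]
    (Dt : ModularParametrizationData W N), W.conductorNorm ℤ = N →
    ∀ sgn : ℂ, (sgn = 1 ∨ sgn = -1) →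
      ∃ q : ℕ, q.Prime ∧ (q : ℝ) ≤ (N : ℝ) ^ B ∧
        ∃ χ : DirichletCharacter ℂ q, χ.IsPrimitive ∧ χ (-1) = sgn ∧
          ∃ L : ℂ → ℂ, Differentiable ℂ L ∧ (∀ s : ℂ, 2 < s.re → L s = twistedLSeries Dt.f χ s) ∧
            c * (N : ℝ) ^ (-β) ≤ ‖L 1‖

/-- **R14 `PolyShaAnRat A`**: the analytic order of Ш of every globally minimal elliptic `W/ℚ` of analytic rank
`0` is `≤ C · N^A` (`shaAn W = L(E,1)·#E_tors²/(Ω·∏c_p)` in rank 0; UNCONDITIONAL currency — no BSD).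
Goldfeld–Szpiro's conjecture is `A = ½ + ε` (for `#Ш`, via BSD); with a rank-0 non-vanishing twist input it feeds
`PolyFaltingsHeightRat` (lens-5 map M14). OPEN; an INPUT row, no theorem of this file uses it.
«NOT abc — POLY-SZPIRO(E)» input (D-0139/D-0140). [cite: GoldfeldSzpiro1995, (1.1)] -/
@[conjecture] def PolyShaAnRat (A : ℝ) : Prop :=
  ∃ C : ℝ, ∀ (W : WeierstrassCurve ℚ) [W.IsElliptic] [W.IsGloballyMinimal],
    W.analyticRank = 0 → ‖shaAn W‖ ≤ C * ((W.conductorNorm ℤ : ℝ)) ^ A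

universe u in
/-- **R15 `PolyHeegnerHeightRat A B`**: the canonical height of a Heegner point `P_K ∈ E(K)` of level `N = N_E`
over an imaginary quadratic `K` satisfying the Heegner hypothesis is `≤ C · N^A · |d_K|^B` (expected from
Gross–Zagier + convexity: `A = 3/2+ε, B = 1+ε`; Lindelöf: `A = 1+ε, B = ½+ε`). With the tree's
`GrossZagierFormula` (`L'(E/K,1) = (2 covol Λ_E /(c² u² √|d_K|)) · ĥ(P_K)`) and a lower bound for `L'(E/K,1)` it
bounds `covol(Λ_E)` from below, i.e. feeds `PolyPeriodLowerBoundRat`. OPEN; an INPUT row, no theorem of this file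
uses it. «NOT abc — POLY-SZPIRO(E)» input (D-0139/D-0140). [cite: GrossZagier1986, Thm. I.6.3] -/
@[conjecture] def PolyHeegnerHeightRat (A B : ℝ) : Prop :=
  ∃ C : ℝ, ∀ (W : WeierstrassCurve ℚ) [W.IsElliptic] [W.IsGloballyMinimal] (N : ℕ) [NeZero N]
    (K : Type u) [Field K] [NumberField K] (Dt : ModularParametrizationData W N)
    (H : HeegnerDatum N (NumberField.discr K)) (ι : K →+* ℂ) (P : (W.baseChange K).toAffine.Point),
    IsImaginaryQuadratic K → SatisfiesHeegnerHypothesis N K → W.conductorNorm ℤ = N →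
    WeierstrassCurve.Affine.Point.map ι.toRatAlgHom P = heegnerPointComplex Dt H →
    P.canonicalHeight ≤ C * (N : ℝ) ^ A * |(NumberField.discr K : ℝ)| ^ B

/-! ## §2 THMDOOR-1a: Goldfeld's period form ⇔ the height door R5 (PROVED, hypothesis-free) -/

/-- **Period lower bound ⇒ height upper bound**, same exponent, constant halved: `h_F = −½ log(complexPeriod/2)` on a
global minimal model (`faltingsHeight_eq_neg_half_log`), transported to any model (`hasGlobalMinimalModel_rat_holds`,
invariance of `h_F` and `N`). [cite: Goldfeld1990ModularElliptic, §4 (4)] [cite: PastenShimura2024, §3 (p. 13)] -/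
theorem polyFaltingsHeightRatEff_of_polyPeriodLowerBoundRatEff {κ C : ℝ}
    (h : PolyPeriodLowerBoundRatEff κ C) : PolyFaltingsHeightRatEff κ (C / 2) := by
  intro W _
  obtain ⟨Cv, hV⟩ := hasGlobalMinimalModel_rat_holds W
  haveI : (Cv • W).IsGloballyMinimal := hV
  have hNpos : (0 : ℝ) < ((Cv • W).conductorNorm ℤ : ℝ) := by
    exact_mod_cast conductorNorm_pos_holds (Cv • W)
  have hper := h (Cv • W)
  rw [← faltingsHeight_smul W Cv, ← conductorNorm_smul_rat W Cv, faltingsHeight_eq_neg_half_log]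
  have hlow : 0 < Real.exp (-C) * ((Cv • W).conductorNorm ℤ : ℝ) ^ (-(2 * κ)) := by positivity
  have hlog := Real.log_le_log hlow hper
  rw [Real.log_mul (Real.exp_pos _).ne' (Real.rpow_pos_of_pos hNpos _).ne', Real.log_exp,
    Real.log_rpow hNpos] at hlog
  linarith

/-- **Height upper bound ⇒ period lower bound** (the converse, same identity, constant doubled).
[cite: Goldfeld1990ModularElliptic, §4 (4)] [cite: PastenShimura2024, §3 (p. 13)] -/
theorem polyPeriodLowerBoundRatEff_of_polyFaltingsHeightRatEff {κ C : ℝ}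
    (h : PolyFaltingsHeightRatEff κ C) : PolyPeriodLowerBoundRatEff κ (2 * C) := by
  intro W _ _
  have hh := h W
  rw [faltingsHeight_eq_neg_half_log] at hh
  have hNpos : (0 : ℝ) < (W.conductorNorm ℤ : ℝ) := by exact_mod_cast conductorNorm_pos_holds W
  have hcp : 0 < (W.baseChange ℂ).complexPeriod / 2 := by
    have := (W.baseChange ℂ).complexPeriod_pos'
    positivity
  have hlow : 0 < Real.exp (-(2 * C)) * ((W.conductorNorm ℤ : ℝ)) ^ (-(2 * κ)) := by positivity
  rw [← Real.log_le_log_iff hlow hcp, Real.log_mul (Real.exp_pos _).ne'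
    (Real.rpow_pos_of_pos hNpos _).ne', Real.log_exp, Real.log_rpow hNpos]
  linarith

/-- **R17♭ certificate: Goldfeld's period form ⇔ the height row R5, same exponent** — a RESTATEMENT inside the
A-PS class, kernel-checked. [cite: Goldfeld1990ModularElliptic, §4 "Equivalent forms of Szpiro's conjecture"] -/
theorem polyPeriodLowerBoundRat_iff_polyFaltingsHeightRat (κ : ℝ) :
    PolyPeriodLowerBoundRat κ ↔ PolyFaltingsHeightRat κ :=
  ⟨fun ⟨C, h⟩ => ⟨C / 2, polyFaltingsHeightRatEff_of_polyPeriodLowerBoundRatEff h⟩,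
    fun ⟨C, h⟩ => ⟨2 * C, polyPeriodLowerBoundRatEff_of_polyFaltingsHeightRatEff h⟩⟩

/-- **Effective A-PS from Goldfeld's period form**: `PolyPeriodLowerBoundRatEff κ C → PolySzpiroRatEff (12κ) (6C + 16)`
(period ⇒ height `C/2`, then the landed S2 `12·(C/2) + 16`). «NOT abc — POLY-SZPIRO(12κ)», EFFECTIVE.
[cite: Goldfeld1990ModularElliptic, §4] [cite: PastenShimura2024, §3 (3.1)] -/
theorem polySzpiroRatEff_of_polyPeriodLowerBoundRatEff {κ C : ℝ} (h : PolyPeriodLowerBoundRatEff κ C) :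
    Summit.ABC.PolySzpiroRatEff (12 * κ) (6 * C + 16) := by
  have h1 := polySzpiroRatEff_of_polyFaltingsHeightRatEff' (polyFaltingsHeightRatEff_of_polyPeriodLowerBoundRatEff h)
  have hC : 12 * (C / 2) + 16 = 6 * C + 16 := by ring
  rw [hC] at h1
  exact h1

/-- **A-PS from Goldfeld's period form, BY NAME**: `PolyPeriodLowerBoundRat κ → Summit.ABC.PolySzpiroRat`
(exponent `12κ`, via the landed R5 edge `polySzpiroRat_of_polyFaltingsHeightRat`). «NOT abc — POLY-SZPIRO(12κ)».
[cite: Goldfeld1990ModularElliptic, §4 Conj. 1] -/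
theorem polySzpiroRat_of_polyPeriodLowerBoundRat {κ : ℝ} (h : PolyPeriodLowerBoundRat κ) :
    Summit.ABC.PolySzpiroRat :=
  polySzpiroRat_of_polyFaltingsHeightRat ((polyPeriodLowerBoundRat_iff_polyFaltingsHeightRat κ).1 h)

/-! ## §3 THMDOOR-1b: the Goldfeld dictionary `PolyModSymRat ⇒ PolyPeriodLowerBoundRat` (PROVED implication) -/

section Dictionary

/-- **THE GOLDFELD DICTIONARY THEOREM (R17(b) ⇒ R17♭, PROVED as an implication).** Modulo the KNOWN named facts
modularity (`hmod`) and Mazur–Kenku (`h163`):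
`PolyModSymRat κ B → TwistedCentralValueLowerBound B β → PolyPeriodLowerBoundRat (κ + β + B/2)`.
For a globally minimal `W` of conductor `N` with datum `D`: for each parity the twisted-value input gives a prime
`q ≤ C_B N^B` and a primitive `χ` with `|L(f⊗χ,1)| ≥ c N^{-β}`; Birch + the symbol bound `C N^κ` give
`Ω^±_f ≥ c N^{-β} / (√(C_B N^B) · C N^κ)` (`sqrt_mul_norm_twistedL_le_plus/minus`); the period sandwich
(`periods_le_mul_covolume`) gives `covol(Λ_W) ≥ Ω⁺_f Ω⁻_f / 652 ≥ c' · N^{-2(κ+β+B/2)}`. This is Goldfeld 1990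
"Assuming the Taniyama–Weil conjecture, Conjecture 4 [implies] Szpiro's Conjecture 1", with Taniyama–Weil now
the theorem `hmod`, the analytic mean-value step isolated as the typed hypothesis `TwistedCentralValueLowerBound`,
and NO Manin-constant hypothesis (the `μ` of lens-5's map M17 is `0`: `c² ≥ 1` is on the right side here).
RESULT for the census (RC-12): «modular-symbol growth `κ` + one not-tiny twisted central value of conductor `≤ N^B`
⇒ period lower bound ⇒ `PolyFaltingsHeightRat (κ+β+B/2)` ⇒ A-PS(12κ + 12β + 6B)», every hypothesis a typed Prop,
the implication kernel-checked. abc is NOT proved; A-PS is «NOT abc — POLY-SZPIRO(E)».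
[cite: Goldfeld1990ModularElliptic, §4 Conj. 4 and (5)–(8)] [cite: Birch1971] [cite: ZagierCMB1985, §1] -/
theorem polyPeriodLowerBoundRat_of_polyModSymRat {κ B β : ℝ} (hmod : nonempty_modularParametrizationData)
    (h163 : PastenShimura2024_minimalDegree_le_163_mul)
    (hsym : PolyModSymRat κ B) (htw : TwistedCentralValueLowerBound B β) :
    PolyPeriodLowerBoundRat (κ + β + B / 2) := by
  obtain ⟨C₀, hC₀⟩ := hsym
  obtain ⟨c, hc, htw⟩ := htw
  -- a positive symbol constant
  set C := max C₀ 1 with hCdef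
  have hC1 : 1 ≤ C := le_max_right _ _
  have hCpos : 0 < C := lt_of_lt_of_le one_pos hC1
  refine ⟨-Real.log (c ^ 2 / (652 * C ^ 2)), fun W _ _ => ?_⟩
  haveI : NeZero (W.conductorNorm ℤ) := NeZero.of_pos (conductorNorm_pos_holds W)
  have hNpos : (0 : ℝ) < ((W.conductorNorm ℤ : ℕ) : ℝ) := by exact_mod_cast conductorNorm_pos_holds W
  set x : ℝ := ((W.conductorNorm ℤ : ℕ) : ℝ) with hxdef
  obtain ⟨D⟩ := hmod W
  have hplus : 0 < plusPeriod D.f := D.plusPeriod_newform_pos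
  have hminus : 0 < minusPeriod D.f :=
    IsNewform0.minusPeriod_pos_holds D.isNewformOf.1 D.isNewformOf.coeffField_eq_bot
  have hsymD := hC₀ W (W.conductorNorm ℤ) D rfl
  have hxκ : 0 ≤ x ^ κ := Real.rpow_nonneg hNpos.le κ
  -- EVEN character: `c x^{-β} ≤ √(x^B) · C x^κ · Ω⁺_f`
  obtain ⟨q, hq, hqle, χ, hχ, hχ1, L, hL, hL', hval⟩ := htw W (W.conductorNorm ℤ) D rfl 1 (Or.inl rfl)
  haveI : NeZero q := ⟨hq.ne_zero⟩
  have hqpos : (0 : ℝ) < q := by exact_mod_cast hq.pos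
  have hMp : ∀ a : ℤ, |normalizedPlusSymbol D.f ((a : ℚ) / q)| ≤ C * x ^ κ := fun a =>
    ((hsymD q hq hqle a).1).trans (mul_le_mul_of_nonneg_right (le_max_left _ _) hxκ)
  have hP : c * x ^ (-β) ≤ Real.sqrt (x ^ B) * (C * x ^ κ) * plusPeriod D.f :=
    hval.trans (le_sqrt_mul_of_sqrt_mul_le hqpos hqle (by positivity) hplus.le
      (sqrt_mul_norm_twistedL_le_plus D hχ hχ1 hL hL' hMp))
  -- ODD character: `c x^{-β} ≤ √(x^B) · C x^κ · Ω⁻_f`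
  obtain ⟨q', hq', hqle', χ', hχ', hχ1', L', hL₁, hL₁', hval'⟩ :=
    htw W (W.conductorNorm ℤ) D rfl (-1) (Or.inr rfl)
  haveI : NeZero q' := ⟨hq'.ne_zero⟩
  have hqpos' : (0 : ℝ) < q' := by exact_mod_cast hq'.pos
  have hMm : ∀ a : ℤ, |normalizedMinusSymbol D.f ((a : ℚ) / q')| ≤ C * x ^ κ := fun a =>
    ((hsymD q' hq' hqle' a).2).trans (mul_le_mul_of_nonneg_right (le_max_left _ _) hxκ)
  have hM : c * x ^ (-β) ≤ Real.sqrt (x ^ B) * (C * x ^ κ) * minusPeriod D.f :=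
    hval'.trans (le_sqrt_mul_of_sqrt_mul_le hqpos' hqle' (by positivity) hminus.le
      (sqrt_mul_norm_twistedL_le_minus D hχ' hχ1' hL₁ hL₁' hMm))
  -- the sandwich and the covolume of the (Néron) lattice of `D`
  have hsand : plusPeriod D.f * minusPeriod D.f ≤ 652 * ZLattice.covolume D.L.lattice :=
    periods_le_mul_covolume hmod h163 W D
  have hcov_eq : (W.baseChange ℂ).complexPeriod / 2 = ZLattice.covolume D.L.lattice := by
    have h2 := D.two_mul_covolume_eq_complexPeriod
    linarith
  have hcov : 0 < ZLattice.covolume D.L.lattice := ZLattice.covolume_pos _ _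
  rw [hcov_eq, neg_neg, Real.exp_log (by positivity)]
  -- bookkeeping of the exponents
  have hsq : Real.sqrt (x ^ B) * Real.sqrt (x ^ B) = x ^ B := Real.mul_self_sqrt (Real.rpow_nonneg hNpos.le B)
  have hcβ : 0 ≤ c * x ^ (-β) := by positivity
  have hprod : (c * x ^ (-β)) * (c * x ^ (-β)) ≤
      (Real.sqrt (x ^ B) * (C * x ^ κ) * plusPeriod D.f) * (Real.sqrt (x ^ B) * (C * x ^ κ) * minusPeriod D.f) :=
    mul_le_mul hP hM hcβ (hcβ.trans hP)
  have k1 : c ^ 2 * (x ^ (-β) * x ^ (-β)) = (c * x ^ (-β)) * (c * x ^ (-β)) := by ring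
  have k2 : (Real.sqrt (x ^ B) * (C * x ^ κ) * plusPeriod D.f) *
      (Real.sqrt (x ^ B) * (C * x ^ κ) * minusPeriod D.f) =
      (Real.sqrt (x ^ B) * Real.sqrt (x ^ B)) * C ^ 2 * (x ^ κ * x ^ κ) *
        (plusPeriod D.f * minusPeriod D.f) := by ring
  rw [hsq] at k2
  have k3 : x ^ B * C ^ 2 * (x ^ κ * x ^ κ) * (plusPeriod D.f * minusPeriod D.f) ≤
      x ^ B * C ^ 2 * (x ^ κ * x ^ κ) * (652 * ZLattice.covolume D.L.lattice) :=
    mul_le_mul_of_nonneg_left hsand (by positivity)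
  have k4 : x ^ B * C ^ 2 * (x ^ κ * x ^ κ) * (652 * ZLattice.covolume D.L.lattice) =
      ZLattice.covolume D.L.lattice * (652 * C ^ 2 * (x ^ B * x ^ κ * x ^ κ)) := by ring
  have key : c ^ 2 * (x ^ (-β) * x ^ (-β)) ≤
      ZLattice.covolume D.L.lattice * (652 * C ^ 2 * (x ^ B * x ^ κ * x ^ κ)) :=
    (k1.trans_le (hprod.trans (k2.le.trans k3))).trans_eq k4
  have hx : x ^ (-(2 * (κ + β + B / 2))) = x ^ (-β) * x ^ (-β) / (x ^ B * x ^ κ * x ^ κ) := by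
    rw [show -(2 * (κ + β + B / 2)) = (-β + -β) - (B + κ + κ) by ring, Real.rpow_sub hNpos,
      Real.rpow_add hNpos, Real.rpow_add hNpos, Real.rpow_add hNpos]
  have k5 : c ^ 2 / (652 * C ^ 2) * (x ^ (-β) * x ^ (-β) / (x ^ B * x ^ κ * x ^ κ)) =
      c ^ 2 * (x ^ (-β) * x ^ (-β)) / (652 * C ^ 2 * (x ^ B * x ^ κ * x ^ κ)) :=
    div_mul_div_comm _ _ _ _
  rw [hx, k5, div_le_iff₀ (by positivity)]
  exact key

/-- **Corollaries BY NAME**: Goldfeld's dictionary lands in the height row and in A-PS —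
`PolyModSymRat κ B → TwistedCentralValueLowerBound B β → PolyFaltingsHeightRat (κ + β + B/2)` and
`→ Summit.ABC.PolySzpiroRat` (exponent `12κ + 12β + 6B`), modulo modularity and Mazur–Kenku. «NOT abc —
POLY-SZPIRO(12κ + 12β + 6B)» (D-0139/D-0140). [cite: Goldfeld1990ModularElliptic, §4 Conj. 4 ⇒ Conj. 1] -/
theorem polyFaltingsHeightRat_of_polyModSymRat {κ B β : ℝ} (hmod : nonempty_modularParametrizationData)
    (h163 : PastenShimura2024_minimalDegree_le_163_mul)
    (hsym : PolyModSymRat κ B) (htw : TwistedCentralValueLowerBound B β) :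
    PolyFaltingsHeightRat (κ + β + B / 2) :=
  (polyPeriodLowerBoundRat_iff_polyFaltingsHeightRat _).1 (polyPeriodLowerBoundRat_of_polyModSymRat hmod h163 hsym htw)

/-- **Goldfeld 1990, Conj. 4 ⇒ Conj. 1, in the kernel**: `PolyModSymRat κ B → TwistedCentralValueLowerBound B β →
Summit.ABC.PolySzpiroRat`, modulo modularity (`hmod`) and Mazur–Kenku (`h163`). abc is NOT proved; A-PS is
«NOT abc — POLY-SZPIRO(12κ + 12β + 6B)». [cite: Goldfeld1990ModularElliptic, §4 "Assuming the Taniyama–Weil conjecture, Conjecture 4 is equivalent to Szpiro's Conjecture 1"] -/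
theorem polySzpiroRat_of_polyModSymRat {κ B β : ℝ} (hmod : nonempty_modularParametrizationData)
    (h163 : PastenShimura2024_minimalDegree_le_163_mul)
    (hsym : PolyModSymRat κ B) (htw : TwistedCentralValueLowerBound B β) : Summit.ABC.PolySzpiroRat :=
  polySzpiroRat_of_polyPeriodLowerBoundRat (polyPeriodLowerBoundRat_of_polyModSymRat hmod h163 hsym htw)

end Dictionary



end Summit.ABC.Analytic

end
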